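import Mathlib.Analysis.Calculus.Deriv.Mul
import Mathlib.Analysis.Calculus.Deriv.Prod
import Mathlib.Analysis.Calculus.Deriv.Comp
import Mathlib.Analysis.Calculus.FDeriv.Prod
import Mathlib.Analysis.Calculus.TangentCone.Prod
import Literature.Geometry.Lorentzian.CoordBianchi
import HarnessLib

/-!
# First variation of the Levi-Civita connection and of the curvature, in coordinates

Third layer of the coordinate tensor calculus of `CoordCurvature.lean` / `CoordBianchi.lean`
(metric components `G : E → (E →L E →L ℝ)` on a finite-dimensional real normed space `E`).
Here the components depend on a real parameter: `G : ℝ → E → (E →L E →L ℝ)`, a **smooth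
one-parameter family** on the time set `S ⊆ ℝ` and the open set `V ⊆ E` (`IsMetricFamilyOn`:
each `G t`, `t ∈ S`, is smooth, symmetric and nondegenerate on `V`; `(x, t) ↦ G t x` is `C^∞`
on `V × S`; `S` has unique derivatives and no isolated points, e.g. `S = [0, T]`, `T > 0`).
Writing `h = ∂G/∂t` (`tDeriv`, the derivative within `S`, one-sided at end points) we prove,
at `t ∈ S`, `x ∈ V`:

* `hasDerivWithinAt_fderiv_slice` — the analytic input: **mixed partial derivatives commute**
  for a `C^∞` map on `V × S` (`∂_t ∂_x = ∂_x ∂_t`, from the symmetry of the second derivative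
  within `V × S`, Mathlib's `ContDiffWithinAt.isSymmSndFDerivWithinAt`);
* `IsMetricFamilyOn.hasDerivWithinAt_sharpAt` — `∂_t ♯ = −♯ ∘ h ∘ ♯`;
* `IsMetricFamilyOn.hasDerivWithinAt_chrAt` and `apply_varChrAt` — **Topping 2006,
  Prop. 2.3.1**: the Christoffel map is differentiable in `t` with derivative the tensor
  `Π = varChrAt G S t x`, `G(Π(X,Y), Z) = ½[(∇_X h)(Y,Z) + (∇_Y h)(X,Z) − (∇_Z h)(X,Y)]`;
* `IsMetricFamilyOn.hasDerivWithinAt_riemAt` — **Topping 2006, Prop. 2.3.4** in the form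
  `∂_t R(X,Y) = D_XΠ_Y − D_YΠ_X + Π_X Γ_Y + Γ_X Π_Y − Π_Y Γ_X − Γ_Y Π_X`
  (`= (∇_XΠ)(Y,·) − (∇_YΠ)(X,·)`; the sign differs from Topping's display because his curvature
  is `−R(X,Y)` of ours).

All statements are `HasDerivWithinAt … S t`, so they apply up to the end points of a closed time
interval. Everything is proved; the file introduces the predicate `IsMetricFamilyOn` and the
definitions `tDeriv`, `varChrAt` (no statement is left as a hypothesis).

## References

* P. Topping, *Lectures on the Ricci flow*, LMS Lecture Note Series 325, CUP 2006, §2.3.1,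
  Prop. 2.3.1 and Remark 2.3.2 (variation of `∇`), Prop. 2.3.4 (variation of `Rm`), §2.3.2
  (the calculations). [Topping2006]
* B. O'Neill, *Semi-Riemannian geometry with applications to relativity*, Academic Press 1983,
  Ch. 3, Prop. 3.13, Lemma 3.38. [ONeill1983]
-/

noncomputable section

set_option maxSynthPendingDepth 3

open Set Filter ContinuousLinearMap Module
open scoped Topology ContDiff

namespace Literature.Geometry.Lorentzian

namespace MetricCoord

variable {E : Type*} [NormedAddCommGroup E] [NormedSpace ℝ E]

/-! ### Mixed partial derivatives of a smooth map on `V × S` -/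

section Mixed

variable {W : Type*} [NormedAddCommGroup W] [NormedSpace ℝ W]
  {F : E × ℝ → W} {V : Set E} {S : Set ℝ} {x : E} {t : ℝ}

/-- The slices `y ↦ F (y, s)` of a map differentiable within `V × S` have, at the points of the
open set `V`, the derivative `DF(y,s) ∘ inl`. [folklore] -/
theorem hasFDerivAt_slice (hV : IsOpen V) (hF : DifferentiableOn ℝ F (V ×ˢ S)) (hx : x ∈ V)
    (ht : t ∈ S) :
    HasFDerivAt (fun y ↦ F (y, t))
      ((fderivWithin ℝ F (V ×ˢ S) (x, t)).comp (ContinuousLinearMap.inl ℝ E ℝ)) x := by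
  have hd : HasFDerivWithinAt F (fderivWithin ℝ F (V ×ˢ S) (x, t)) (V ×ˢ S) (x, t) :=
    (hF (x, t) ⟨hx, ht⟩).hasFDerivWithinAt
  have hi : HasFDerivWithinAt (fun y : E ↦ (y, t)) (ContinuousLinearMap.inl ℝ E ℝ) V x :=
    ((ContinuousLinearMap.inl ℝ E ℝ).hasFDerivAt.add_const (0, t)).hasFDerivWithinAt.congr
      (fun y _ ↦ by simp) (by simp)
  have hcomp := hd.comp x hi (fun y hy ↦ Set.mk_mem_prod hy ht)
  exact hcomp.hasFDerivAt (hV.mem_nhds hx)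

/-- The time slices `s ↦ F (y, s)` have, within `S`, the derivative `DF(y,t)(0,1)`. [folklore] -/
theorem hasDerivWithinAt_tslice (hF : DifferentiableOn ℝ F (V ×ˢ S)) (hx : x ∈ V) (ht : t ∈ S) :
    HasDerivWithinAt (fun s ↦ F (x, s)) (fderivWithin ℝ F (V ×ˢ S) (x, t) ((0 : E), (1 : ℝ))) S t := by
  have hd : HasFDerivWithinAt F (fderivWithin ℝ F (V ×ˢ S) (x, t)) (V ×ˢ S) (x, t) :=
    (hF (x, t) ⟨hx, ht⟩).hasFDerivWithinAt
  have hc : HasDerivWithinAt (fun s : ℝ ↦ (x, s)) ((0 : E), (1 : ℝ)) S t :=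
    HasDerivWithinAt.prodMk (hasDerivWithinAt_const _ _ _) (hasDerivWithinAt_id _ _)
  exact hd.comp_hasDerivWithinAt t hc (fun s hs ↦ Set.mk_mem_prod hx hs)

/-- The field of `x`-derivatives of the slices is `C^∞` on `V × S` when `F` is. [folklore] -/
theorem contDiffOn_fderiv_slice (hV : IsOpen V) (hS : UniqueDiffOn ℝ S)
    (hF : ContDiffOn ℝ ∞ F (V ×ˢ S)) :
    ContDiffOn ℝ ∞ (fun q : E × ℝ ↦ fderiv ℝ (fun y ↦ F (y, q.2)) q.1) (V ×ˢ S) := by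
  have hQ : UniqueDiffOn ℝ (V ×ˢ S) := UniqueDiffOn.prod hV.uniqueDiffOn hS
  have hD : ContDiffOn ℝ ∞ (fun q ↦ (fderivWithin ℝ F (V ×ˢ S) q).comp (ContinuousLinearMap.inl ℝ E ℝ))
      (V ×ˢ S) :=
    (hF.fderivWithin hQ (by simp)).clm_comp contDiffOn_const
  refine hD.congr fun q hq ↦ ?_
  exact (hasFDerivAt_slice hV (hF.differentiableOn (by simp)) hq.1 hq.2).fderiv

/-- The time derivative of the slices is `C^∞` in `x` on `V`, for each `t ∈ S`. [folklore] -/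
theorem contDiffOn_derivWithin_tslice (hV : IsOpen V) (hS : UniqueDiffOn ℝ S)
    (hF : ContDiffOn ℝ ∞ F (V ×ˢ S)) (ht : t ∈ S) :
    ContDiffOn ℝ ∞ (fun y ↦ derivWithin (fun s ↦ F (y, s)) S t) V := by
  have hQ : UniqueDiffOn ℝ (V ×ˢ S) := UniqueDiffOn.prod hV.uniqueDiffOn hS
  have hD : ContDiffOn ℝ ∞ (fderivWithin ℝ F (V ×ˢ S)) (V ×ˢ S) := hF.fderivWithin hQ (by simp)
  have hsl : ContDiffOn ℝ ∞ (fun y ↦ fderivWithin ℝ F (V ×ˢ S) (y, t) ((0 : E), (1 : ℝ))) V := by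
    have hmap : ContDiffOn ℝ ∞ (fun y : E ↦ (y, t)) V := (contDiff_id.prodMk contDiff_const).contDiffOn
    exact (hD.comp hmap fun y hy ↦ ⟨hy, ht⟩).clm_apply contDiffOn_const
  refine hsl.congr fun y hy ↦ ?_
  exact (hasDerivWithinAt_tslice (hF.differentiableOn (by simp)) hy ht).derivWithin (hS t ht)

/-- **Mixed partial derivatives commute** for a map `F` of class `C^∞` on `V × S` (`V` open, `S`
with unique derivatives, `t ∈ S` not isolated from the interior of `S`): the time derivative,
within `S`, of the `x`-derivative of the slices is the `x`-derivative of the time derivative,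
`∂_t (D_x F) = D_x (∂_t F)` (symmetry of the second derivative within `V × S`). [folklore] -/
theorem hasDerivWithinAt_fderiv_slice (hV : IsOpen V) (hS : UniqueDiffOn ℝ S)
    (hF : ContDiffOn ℝ ∞ F (V ×ˢ S)) (hx : x ∈ V) (ht : t ∈ S) (ht' : t ∈ closure (interior S)) :
    HasDerivWithinAt (fun s ↦ fderiv ℝ (fun y ↦ F (y, s)) x)
      (fderiv ℝ (fun y ↦ derivWithin (fun s ↦ F (y, s)) S t) x) S t := by
  have hQ : UniqueDiffOn ℝ (V ×ˢ S) := UniqueDiffOn.prod hV.uniqueDiffOn hS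
  have hFd : DifferentiableOn ℝ F (V ×ˢ S) := hF.differentiableOn (by simp)
  set D := fderivWithin ℝ F (V ×ˢ S) with hDdef
  have hD : ContDiffOn ℝ ∞ D (V ×ˢ S) := hF.fderivWithin hQ (by simp)
  have hDd : DifferentiableOn ℝ D (V ×ˢ S) := hD.differentiableOn (by simp)
  set D2 := fderivWithin ℝ D (V ×ˢ S) (x, t) with hD2def
  -- (a) the function agrees on `S` with `s ↦ D(x,s) ∘ inl`
  have hfun : ∀ s ∈ S, fderiv ℝ (fun y ↦ F (y, s)) x = (D (x, s)).comp (ContinuousLinearMap.inl ℝ E ℝ) :=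
    fun s hs ↦ (hasFDerivAt_slice hV hFd hx hs).fderiv
  -- (b) derivative of `s ↦ D(x,s) ∘ inl`
  have hb : HasDerivWithinAt (fun s ↦ (D (x, s)).comp (ContinuousLinearMap.inl ℝ E ℝ))
      ((D2 ((0 : E), (1 : ℝ))).comp (ContinuousLinearMap.inl ℝ E ℝ)) S t := by
    have h1 : HasDerivWithinAt (fun s ↦ D (x, s)) (D2 ((0 : E), (1 : ℝ))) S t :=
      hasDerivWithinAt_tslice hDd hx ht
    exact (((ContinuousLinearMap.compL ℝ E (E × ℝ) W).flip
      (ContinuousLinearMap.inl ℝ E ℝ)).hasFDerivAt.comp_hasDerivWithinAt t h1 :)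
  -- (c) the `x`-derivative of the time derivative
  have hc : fderiv ℝ (fun y ↦ derivWithin (fun s ↦ F (y, s)) S t) x =
      (D2.comp (ContinuousLinearMap.inl ℝ E ℝ)).flip ((0 : E), (1 : ℝ)) := by
    have heq : (fun y ↦ derivWithin (fun s ↦ F (y, s)) S t) =ᶠ[𝓝 x]
        fun y ↦ D (y, t) ((0 : E), (1 : ℝ)) :=
      (hV.mem_nhds hx |> fun h ↦ Filter.eventually_of_mem h fun y hy ↦
        (hasDerivWithinAt_tslice hFd hy ht).derivWithin (hS t ht))
    rw [heq.fderiv_eq]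
    have hsl : HasFDerivAt (fun y ↦ D (y, t)) (D2.comp (ContinuousLinearMap.inl ℝ E ℝ)) x :=
      hasFDerivAt_slice hV hDd hx ht
    exact (hasFDerivAt_clm_apply_const hsl _).fderiv
  -- (d) symmetry of the second derivative within `V × S`
  have hsymm : IsSymmSndFDerivWithinAt ℝ F (V ×ˢ S) (x, t) := by
    refine (hF (x, t) ⟨hx, ht⟩).isSymmSndFDerivWithinAt two_le_infty hQ ?_ ⟨hx, ht⟩
    have : (x, t) ∈ closure (interior V) ×ˢ closure (interior S) :=
      ⟨subset_closure (by rwa [hV.interior_eq]), ht'⟩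
    rw [← closure_prod_eq, ← interior_prod_eq] at this
    exact this
  have hval : (D2 ((0 : E), (1 : ℝ))).comp (ContinuousLinearMap.inl ℝ E ℝ) =
      (D2.comp (ContinuousLinearMap.inl ℝ E ℝ)).flip ((0 : E), (1 : ℝ)) := by
    ext v
    simp only [ContinuousLinearMap.comp_apply, ContinuousLinearMap.inl_apply,
      ContinuousLinearMap.flip_apply]
    exact hsymm _ _
  rw [hc, ← hval]
  exact hb.congr_of_mem (fun s hs ↦ hfun s hs) ht

end Mixed

/-! ### Smooth one-parameter families of metric components -/

/-- A **smooth one-parameter family of metric components** on the time set `S ⊆ ℝ` and the open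
set `V ⊆ E`: every `G t`, `t ∈ S`, is smooth, symmetric and nondegenerate on `V`
(`IsMetricOn`); `(x, t) ↦ G t x` is `C^∞` on `V × S`; and `S` has unique derivatives with every
point adherent to its interior (e.g. an interval with more than one point), so that derivatives
within `S` are meaningful up to the end points. This is the coordinate form of Topping's
standing convention "`g(t)` is a smooth family of smooth metrics, smooth all the way to `t = 0`
and `t = T`" (Topping 2006, §1.2.3 and §2.3). [cite: Topping2006, §1.2.3] -/
structure IsMetricFamilyOn (G : ℝ → E → E →L[ℝ] E →L[ℝ] ℝ) (S : Set ℝ) (V : Set E) : Prop where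
  isMetricOn : ∀ t ∈ S, IsMetricOn (G t) V
  contDiffOn : ContDiffOn ℝ ∞ (fun p : E × ℝ ↦ G p.2 p.1) (V ×ˢ S)
  uniqueDiffOn : UniqueDiffOn ℝ S
  subset_closure_interior : S ⊆ closure (interior S)

/-- The **time derivative of the components** `h_t = ∂G/∂t` at `x`, within `S` (one-sided at the
end points of a closed time interval); Topping's `h := ∂g_t/∂t` (2006, §2.3).
[cite: Topping2006, §2.3] -/
def tDeriv (G : ℝ → E → E →L[ℝ] E →L[ℝ] ℝ) (S : Set ℝ) (t : ℝ) (x : E) : E →L[ℝ] E →L[ℝ] ℝ :=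
  derivWithin (fun s ↦ G s x) S t

namespace IsMetricFamilyOn

variable {G : ℝ → E → E →L[ℝ] E →L[ℝ] ℝ} {S : Set ℝ} {V : Set E} {x : E} {t : ℝ}

/-- `V` is open (if `S` is inhabited). [folklore] -/
theorem isOpen (hG : IsMetricFamilyOn G S V) (ht : t ∈ S) : IsOpen V := (hG.isMetricOn t ht).isOpen

/-- `h_t(x) = ∂G/∂t` is the derivative of `s ↦ G s x` within `S`. [folklore] -/
theorem hasDerivWithinAt (hG : IsMetricFamilyOn G S V) (hx : x ∈ V) (ht : t ∈ S) :
    HasDerivWithinAt (fun s ↦ G s x) (tDeriv G S t x) S t := by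
  have h := hasDerivWithinAt_tslice (hG.contDiffOn.differentiableOn (by simp)) hx ht
  simp only at h
  exact (h.differentiableWithinAt.hasDerivWithinAt :)

/-- Components: `s ↦ G s x v w` has derivative `h_t(x)(v,w)` within `S`. [folklore] -/
theorem hasDerivWithinAt_apply₂ (hG : IsMetricFamilyOn G S V) (hx : x ∈ V) (ht : t ∈ S) (v w : E) :
    HasDerivWithinAt (fun s ↦ G s x v w) (tDeriv G S t x v w) S t := by
  have h1 := (hG.hasDerivWithinAt hx ht).clm_apply (hasDerivWithinAt_const t S v)
  simp only [map_zero, add_zero] at h1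
  have h2 := h1.clm_apply (hasDerivWithinAt_const t S w)
  simpa using h2

/-- `h_t` is `C^∞` in `x` on `V`. [folklore] -/
theorem contDiffOn_tDeriv (hG : IsMetricFamilyOn G S V) (ht : t ∈ S) : ContDiffOn ℝ ∞ (tDeriv G S t) V :=
  contDiffOn_derivWithin_tslice (hG.isOpen ht) hG.uniqueDiffOn hG.contDiffOn ht

/-- `h_t` is differentiable in `x` at the points of `V`. [folklore] -/
theorem differentiableAt_tDeriv (hG : IsMetricFamilyOn G S V) (hx : x ∈ V) (ht : t ∈ S) :
    DifferentiableAt ℝ (tDeriv G S t) x :=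
  ((hG.contDiffOn_tDeriv ht x hx).contDiffAt ((hG.isOpen ht).mem_nhds hx)).differentiableAt (by simp)

/-- `h_t(x)` is a symmetric bilinear form (derivative of symmetric forms). [folklore] -/
theorem tDeriv_symm (hG : IsMetricFamilyOn G S V) (hx : x ∈ V) (ht : t ∈ S) (v w : E) :
    tDeriv G S t x v w = tDeriv G S t x w v := by
  have h1 := (hG.hasDerivWithinAt_apply₂ hx ht v w).derivWithin (hG.uniqueDiffOn t ht)
  have h2 := (hG.hasDerivWithinAt_apply₂ hx ht w v).derivWithin (hG.uniqueDiffOn t ht)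
  rw [← h1, ← h2]
  refine derivWithin_congr (fun s hs ↦ ?_) ?_
  · exact (hG.isMetricOn s hs).symm x hx v w
  · exact (hG.isMetricOn t ht).symm x hx v w

/-- **`∂_t D_x G = D_x h`**: the `x`-derivative of the components is differentiable in `t` within
`S`, with derivative the `x`-derivative of `h_t` (mixed partials). [folklore] -/
theorem hasDerivWithinAt_fderiv (hG : IsMetricFamilyOn G S V) (hx : x ∈ V) (ht : t ∈ S) :
    HasDerivWithinAt (fun s ↦ fderiv ℝ (G s) x) (fderiv ℝ (tDeriv G S t) x) S t :=
  hasDerivWithinAt_fderiv_slice (F := fun p : E × ℝ ↦ G p.2 p.1) (hG.isOpen ht) hG.uniqueDiffOn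
    hG.contDiffOn hx ht (hG.subset_closure_interior ht)

/-! ### Variation of `♯`, of the Koszul form and of the Christoffel map (Topping, Prop. 2.3.1) -/

section Sharp

variable [CompleteSpace E]

/-- **`∂_t ♯ = −♯ ∘ h ∘ ♯`**: the inverse metric is differentiable in `t` within `S`
(Topping 2006, §2.3.2, the computation `∂_t g^{ij} = −g^{ik} h_{kl} g^{lj}`). [cite: Topping2006, §2.3.2] -/
theorem hasDerivWithinAt_sharpAt (hG : IsMetricFamilyOn G S V) (hx : x ∈ V) (ht : t ∈ S) :
    HasDerivWithinAt (fun s ↦ sharpAt (G s) x)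
      (-(sharpAt (G t) x).comp ((tDeriv G S t x).comp (sharpAt (G t) x))) S t := by
  have hi := (hG.isMetricOn t ht).isInvertible x hx
  -- `inverse` is differentiable at `G t x`; chain rule with `s ↦ G s x`
  have hinv : DifferentiableAt ℝ (ContinuousLinearMap.inverse : (E →L[ℝ] E →L[ℝ] ℝ) → _) (G t x) :=
    (hi.contDiffAt_map_inverse (n := 1)).differentiableAt one_ne_zero
  set L := fderiv ℝ (ContinuousLinearMap.inverse : (E →L[ℝ] E →L[ℝ] ℝ) → _) (G t x) with hL
  have hcomp : HasDerivWithinAt (fun s ↦ sharpAt (G s) x) (L (tDeriv G S t x)) S t :=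
    hinv.hasFDerivAt.comp_hasDerivWithinAt t (hG.hasDerivWithinAt hx ht)
  -- identify `L h` by differentiating `G s x ∘ ♯_s = id` on `S`
  have hprod := (hG.hasDerivWithinAt hx ht).clm_comp hcomp
  have hconst : HasDerivWithinAt (fun s ↦ (G s x).comp (sharpAt (G s) x)) 0 S t :=
    (hasDerivWithinAt_const t S (ContinuousLinearMap.id ℝ (E →L[ℝ] ℝ))).congr
      (fun s hs ↦ ((hG.isMetricOn s hs).isInvertible x hx).self_comp_inverse) hi.self_comp_inverse
  have heq : (tDeriv G S t x).comp (sharpAt (G t) x) + (G t x).comp (L (tDeriv G S t x)) = 0 :=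
    (hG.uniqueDiffOn t ht).eq_deriv _ hprod hconst
  have h1 : (G t x).comp (L (tDeriv G S t x)) = -(tDeriv G S t x).comp (sharpAt (G t) x) :=
    eq_neg_of_add_eq_zero_right heq
  have h2 : (sharpAt (G t) x).comp ((G t x).comp (L (tDeriv G S t x))) =
      (sharpAt (G t) x).comp (-(tDeriv G S t x).comp (sharpAt (G t) x)) := by rw [h1]
  rw [← ContinuousLinearMap.comp_assoc, show (sharpAt (G t) x).comp (G t x) = ContinuousLinearMap.id ℝ E
    from hi.inverse_comp_self, ContinuousLinearMap.id_comp, ContinuousLinearMap.comp_neg] at h2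
  rw [← h2]
  exact hcomp

omit [CompleteSpace E] in
/-- **`∂_t K = koszulOp (D_x h)`**: the Koszul form is differentiable in `t` within `S`, with
derivative the Koszul operator of the `x`-derivative of `h_t` (`∂_t` and `∂_x` commute).
[cite: Topping2006, §2.3.2] -/
theorem hasDerivWithinAt_koszulCLM (hG : IsMetricFamilyOn G S V) (hx : x ∈ V) (ht : t ∈ S) :
    HasDerivWithinAt (fun s ↦ koszulCLM (G s) x) (koszulOp (fderiv ℝ (tDeriv G S t) x)) S t :=
  koszulOp.hasFDerivAt.comp_hasDerivWithinAt t (hG.hasDerivWithinAt_fderiv hx ht)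

end Sharp

end IsMetricFamilyOn

/-- The **variation of the Christoffel map** `Π = ∂Γ/∂t` at time `t` and point `x`, written out
from `Γ = ½ ♯K`: `Π = ½ [ (−♯ h ♯) ∘ K + ♯ ∘ koszulOp(D_x h) ]` with `h = ∂G/∂t`
(Topping 2006, Prop. 2.3.1 and the display `Π(X,Y) := ∂_t ∇_X Y`; a tensor although `Γ` is not).
[cite: Topping2006, Prop. 2.3.1] -/
def varChrAt [CompleteSpace E] (G : ℝ → E → E →L[ℝ] E →L[ℝ] ℝ) (S : Set ℝ) (t : ℝ) (x : E) :
    E →L[ℝ] E →L[ℝ] E :=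
  (2⁻¹ : ℝ) • ((ContinuousLinearMap.compL ℝ E (E →L[ℝ] ℝ) E
      (-(sharpAt (G t) x).comp ((tDeriv G S t x).comp (sharpAt (G t) x)))).comp (koszulCLM (G t) x)
    + (ContinuousLinearMap.compL ℝ E (E →L[ℝ] ℝ) E (sharpAt (G t) x)).comp
      (koszulOp (fderiv ℝ (tDeriv G S t) x)))

/-- Unfolding lemma for `varChrAt`. [cite: Topping2006, Prop. 2.3.1] -/
theorem varChrAt_apply [CompleteSpace E] (G : ℝ → E → E →L[ℝ] E →L[ℝ] ℝ) (S : Set ℝ) (t : ℝ)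
    (x X Y : E) :
    varChrAt G S t x X Y = (2⁻¹ : ℝ) • (-(sharpAt (G t) x (tDeriv G S t x (sharpAt (G t) x
        (koszulCLM (G t) x X Y)))) + sharpAt (G t) x (koszulOp (fderiv ℝ (tDeriv G S t) x) X Y)) := by
  simp [varChrAt]

namespace IsMetricFamilyOn

variable {G : ℝ → E → E →L[ℝ] E →L[ℝ] ℝ} {S : Set ℝ} {V : Set E} {x : E} {t : ℝ} [CompleteSpace E]

/-- **The Christoffel map is differentiable in `t`, with derivative `Π = varChrAt`**
(Topping 2006, Prop. 2.3.1: `Π(X,Y) := ∂_t ∇_X Y`). [cite: Topping2006, Prop. 2.3.1] -/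
theorem hasDerivWithinAt_chrAt (hG : IsMetricFamilyOn G S V) (hx : x ∈ V) (ht : t ∈ S) :
    HasDerivWithinAt (fun s ↦ chrAt (G s) x) (varChrAt G S t x) S t := by
  have h1 : HasDerivWithinAt (fun s ↦ ContinuousLinearMap.compL ℝ E (E →L[ℝ] ℝ) E (sharpAt (G s) x))
      (ContinuousLinearMap.compL ℝ E (E →L[ℝ] ℝ) E
        (-(sharpAt (G t) x).comp ((tDeriv G S t x).comp (sharpAt (G t) x)))) S t :=
    (ContinuousLinearMap.compL ℝ E (E →L[ℝ] ℝ) E).hasFDerivAt.comp_hasDerivWithinAt t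
      (hG.hasDerivWithinAt_sharpAt hx ht)
  have h2 := (h1.clm_comp (hG.hasDerivWithinAt_koszulCLM hx ht)).const_smul (2⁻¹ : ℝ)
  exact h2

/-- The time derivative of `Γ` read off `hasDerivWithinAt_chrAt`: `∂_t Γ_t(x) = Π_t(x)` within `S`.
[cite: Topping2006, Prop. 2.3.1] -/
theorem derivWithin_chrAt (hG : IsMetricFamilyOn G S V) (hx : x ∈ V) (ht : t ∈ S) :
    derivWithin (fun s ↦ chrAt (G s) x) S t = varChrAt G S t x :=
  (hG.hasDerivWithinAt_chrAt hx ht).derivWithin (hG.uniqueDiffOn t ht)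

omit [CompleteSpace E] in
/-- `D_x h_t` is symmetric in its last two slots (`h_t` is symmetric near `x`). [folklore] -/
theorem fderiv_tDeriv_symm (hG : IsMetricFamilyOn G S V) (hx : x ∈ V) (ht : t ∈ S) (v Y Z : E) :
    fderiv ℝ (tDeriv G S t) x v Y Z = fderiv ℝ (tDeriv G S t) x v Z Y := by
  have hd := hG.differentiableAt_tDeriv hx ht
  rw [← fderiv_clm_apply_const hd Y v, ← fderiv_clm_apply_const hd Z v,
    ← fderiv_clm_apply_const (differentiableAt_clm_apply_const hd Y) Z v,
    ← fderiv_clm_apply_const (differentiableAt_clm_apply_const hd Z) Y v]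
  have heq : (fun y ↦ tDeriv G S t y Y Z) =ᶠ[𝓝 x] fun y ↦ tDeriv G S t y Z Y :=
    ((hG.isOpen ht).mem_nhds hx |> fun h ↦ Filter.eventually_of_mem h fun y hy ↦
      hG.tDeriv_symm hy ht Y Z)
  rw [heq.fderiv_eq]

/-- **Topping 2006, Prop. 2.3.1 (first variation of the Levi-Civita connection), in coordinates**:
`G(Π(X,Y), Z) = ½ [(∇_X h)(Y,Z) + (∇_Y h)(X,Z) − (∇_Z h)(X,Y)]`, where `Π = ∂Γ/∂t`,
`h = ∂G/∂t` and `∇h = cov₂At (G t) (h t)` is the covariant derivative of `h` for `G t`.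
[cite: Topping2006, Prop. 2.3.1] -/
theorem apply_varChrAt (hG : IsMetricFamilyOn G S V) (hx : x ∈ V) (ht : t ∈ S) (X Y Z : E) :
    G t x (varChrAt G S t x X Y) Z =
      2⁻¹ * (cov₂At (G t) (tDeriv G S t) x X Y Z + cov₂At (G t) (tDeriv G S t) x Y X Z
        - cov₂At (G t) (tDeriv G S t) x Z X Y) := by
  have hGt := hG.isMetricOn t ht
  have hi := hGt.isInvertible x hx
  have hsym := hG.tDeriv_symm hx ht
  have hDs := hG.fderiv_tDeriv_symm hx ht
  -- `♯ K(X,Y) = 2 Γ(X,Y)`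
  have hK : sharpAt (G t) x (koszulCLM (G t) x X Y) = (2 : ℝ) • chrAt (G t) x X Y := by
    rw [chrAt_apply, smul_smul]; norm_num
  rw [varChrAt_apply, map_smul, smul_apply, map_add, add_apply, map_neg, neg_apply,
    apply_sharpAt_apply hi, apply_sharpAt_apply hi, hK, map_smul, smul_apply, smul_eq_mul,
    smul_eq_mul, koszulOp_apply]
  simp only [cov₂At_apply]
  rw [hGt.chrAt_comm hx Y X, hGt.chrAt_comm hx Z X, hGt.chrAt_comm hx Z Y,
    hsym Y (chrAt (G t) x X Z), hsym X (chrAt (G t) x Y Z), hDs Y Z X]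
  ring

/-! ### Joint smoothness of `Γ` and the mixed derivative `∂_t D_x Γ = D_x Π` -/

/-- The Christoffel map of the family, `(x, t) ↦ Γ_t(x)`, is `C^∞` on `V × S`. [folklore] -/
theorem contDiffOn_chrAt_family (hG : IsMetricFamilyOn G S V) :
    ContDiffOn ℝ ∞ (fun q : E × ℝ ↦ chrAt (G q.2) q.1) (V ×ˢ S) := by
  by_cases hS : S = ∅
  · simp [hS]
  obtain ⟨t₀, ht₀⟩ := Set.nonempty_iff_ne_empty.mpr hS
  have hV := hG.isOpen ht₀
  -- `♯` along the family
  have hsharp : ContDiffOn ℝ ∞ (fun q : E × ℝ ↦ sharpAt (G q.2) q.1) (V ×ˢ S) := fun q hq ↦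
    (((hG.isMetricOn q.2 hq.2).isInvertible q.1 hq.1).contDiffAt_map_inverse.comp_contDiffWithinAt
      q (hG.contDiffOn q hq) :)
  -- `D_x G` along the family
  have hD : ContDiffOn ℝ ∞ (fun q : E × ℝ ↦ fderiv ℝ (G q.2) q.1) (V ×ˢ S) :=
    contDiffOn_fderiv_slice (F := fun p : E × ℝ ↦ G p.2 p.1) hV hG.uniqueDiffOn hG.contDiffOn
  have hK : ContDiffOn ℝ ∞ (fun q : E × ℝ ↦ koszulCLM (G q.2) q.1) (V ×ˢ S) :=
    koszulOp.contDiff.comp_contDiffOn hD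
  have hA : ContDiffOn ℝ ∞
      (fun q : E × ℝ ↦ ContinuousLinearMap.compL ℝ E (E →L[ℝ] ℝ) E (sharpAt (G q.2) q.1)) (V ×ˢ S) :=
    (ContinuousLinearMap.compL ℝ E (E →L[ℝ] ℝ) E).contDiff.comp_contDiffOn hsharp
  exact (hA.clm_comp hK).const_smul (2⁻¹ : ℝ)

/-- `Π_t` is `C^∞` in `x` on `V`. [folklore] -/
theorem contDiffOn_varChrAt (hG : IsMetricFamilyOn G S V) (ht : t ∈ S) :
    ContDiffOn ℝ ∞ (varChrAt G S t) V := by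
  have heq : ∀ y ∈ V, varChrAt G S t y = derivWithin (fun s ↦ chrAt (G s) y) S t := fun y hy ↦
    (hG.derivWithin_chrAt hy ht).symm
  refine ContDiffOn.congr ?_ heq
  exact contDiffOn_derivWithin_tslice (F := fun q : E × ℝ ↦ chrAt (G q.2) q.1) (hG.isOpen ht)
    hG.uniqueDiffOn hG.contDiffOn_chrAt_family ht

/-- `Π_t` is differentiable in `x` at the points of `V`. [folklore] -/
theorem differentiableAt_varChrAt (hG : IsMetricFamilyOn G S V) (hx : x ∈ V) (ht : t ∈ S) :
    DifferentiableAt ℝ (varChrAt G S t) x :=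
  ((hG.contDiffOn_varChrAt ht x hx).contDiffAt ((hG.isOpen ht).mem_nhds hx)).differentiableAt (by simp)

/-- **`∂_t D_xΓ = D_xΠ`**: the `x`-derivative of the Christoffel map is differentiable in `t`
within `S`, with derivative the `x`-derivative of `Π_t` (mixed partials for the smooth map
`(x,t) ↦ Γ_t(x)`). [cite: Topping2006, §2.3.2] -/
theorem hasDerivWithinAt_fderiv_chrAt (hG : IsMetricFamilyOn G S V) (hx : x ∈ V) (ht : t ∈ S) :
    HasDerivWithinAt (fun s ↦ fderiv ℝ (chrAt (G s)) x) (fderiv ℝ (varChrAt G S t) x) S t := by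
  have h := hasDerivWithinAt_fderiv_slice (F := fun q : E × ℝ ↦ chrAt (G q.2) q.1) (hG.isOpen ht)
    hG.uniqueDiffOn hG.contDiffOn_chrAt_family hx ht (hG.subset_closure_interior ht)
  have heq : (fun y ↦ derivWithin (fun s ↦ chrAt (G s) y) S t) =ᶠ[𝓝 x] varChrAt G S t :=
    ((hG.isOpen ht).mem_nhds hx |> fun h ↦ Filter.eventually_of_mem h fun y hy ↦
      hG.derivWithin_chrAt hy ht)
  rw [heq.fderiv_eq] at h
  exact h

/-! ### Variation of the curvature endomorphism (Topping, Prop. 2.3.4) -/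

end IsMetricFamilyOn

/-- The **variation of the curvature endomorphism** `∂_t R(X,Y)` written out:
`D_XΠ(Y) − D_YΠ(X) + Π_X ∘ Γ_Y + Γ_X ∘ Π_Y − Π_Y ∘ Γ_X − Γ_Y ∘ Π_X ∈ End E` with `Π = varChrAt`,
`Γ = chrAt (G t)` (Topping 2006, Prop. 2.3.4, for the curvature `R(X,Y) = [∇_X,∇_Y]` on
constant fields). [cite: Topping2006, Prop. 2.3.4] -/
def varRiemAt [CompleteSpace E] (G : ℝ → E → E →L[ℝ] E →L[ℝ] ℝ) (S : Set ℝ) (t : ℝ) (x X Y : E) :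
    E →L[ℝ] E :=
  fderiv ℝ (varChrAt G S t) x X Y - fderiv ℝ (varChrAt G S t) x Y X
    + (varChrAt G S t x X).comp (chrAt (G t) x Y) + (chrAt (G t) x X).comp (varChrAt G S t x Y)
    - (varChrAt G S t x Y).comp (chrAt (G t) x X) - (chrAt (G t) x Y).comp (varChrAt G S t x X)

/-- Unfolding lemma for `varRiemAt`. [cite: Topping2006, Prop. 2.3.4] -/
theorem varRiemAt_apply [CompleteSpace E] (G : ℝ → E → E →L[ℝ] E →L[ℝ] ℝ) (S : Set ℝ) (t : ℝ)
    (x X Y Z : E) :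
    varRiemAt G S t x X Y Z = fderiv ℝ (varChrAt G S t) x X Y Z - fderiv ℝ (varChrAt G S t) x Y X Z
      + varChrAt G S t x X (chrAt (G t) x Y Z) + chrAt (G t) x X (varChrAt G S t x Y Z)
      - varChrAt G S t x Y (chrAt (G t) x X Z) - chrAt (G t) x Y (varChrAt G S t x X Z) := rfl

namespace IsMetricFamilyOn

variable {G : ℝ → E → E →L[ℝ] E →L[ℝ] ℝ} {S : Set ℝ} {V : Set E} {x : E} {t : ℝ} [CompleteSpace E]

/-- **Topping 2006, Prop. 2.3.4 (first variation of the curvature), in coordinates.** Along a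
smooth family, `s ↦ R_s(X,Y) ∈ End E` is differentiable in `t` within `S` with derivative
`varRiemAt = D_XΠ(Y) − D_YΠ(X) + Π_X ∘ Γ_Y + Γ_X ∘ Π_Y − Π_Y ∘ Γ_X − Γ_Y ∘ Π_X`
(`Π = varChrAt G S t`, `Γ = chrAt (G t)`, `Π_X = Π(X,·)`), i.e. `(∇_XΠ)(Y,·) − (∇_YΠ)(X,·)` once the
terms `Π(Γ(X,Y),·)` (symmetric in `X, Y`) are added and subtracted; Topping's display
`∂_t R(X,Y)W = (∇_YΠ)(X,W) − (∇_XΠ)(Y,W)` refers to his curvature `−R(X,Y)`.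
[cite: Topping2006, Prop. 2.3.4] -/
theorem hasDerivWithinAt_riemAt (hG : IsMetricFamilyOn G S V) (hx : x ∈ V) (ht : t ∈ S) (X Y : E) :
    HasDerivWithinAt (fun s ↦ riemAt (G s) x X Y) (varRiemAt G S t x X Y) S t := by
  have hD := hG.hasDerivWithinAt_fderiv_chrAt hx ht
  have hΓ := hG.hasDerivWithinAt_chrAt hx ht
  -- evaluations of the CLM-valued derivatives
  have hD2 : ∀ A B : E, HasDerivWithinAt (fun s ↦ fderiv ℝ (chrAt (G s)) x A B)
      (fderiv ℝ (varChrAt G S t) x A B) S t := by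
    intro A B
    have h1 := hD.clm_apply (hasDerivWithinAt_const t S A)
    simp only [map_zero, add_zero] at h1
    have h2 := h1.clm_apply (hasDerivWithinAt_const t S B)
    simpa using h2
  have hΓ1 : ∀ A : E, HasDerivWithinAt (fun s ↦ chrAt (G s) x A) (varChrAt G S t x A) S t := by
    intro A
    have h1 := hΓ.clm_apply (hasDerivWithinAt_const t S A)
    simpa using h1
  have hP : ∀ A B : E, HasDerivWithinAt (fun s ↦ (chrAt (G s) x A).comp (chrAt (G s) x B))
      ((varChrAt G S t x A).comp (chrAt (G t) x B) + (chrAt (G t) x A).comp (varChrAt G S t x B))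
      S t := fun A B ↦ (hΓ1 A).clm_comp (hΓ1 B)
  have key := (((hD2 X Y).sub (hD2 Y X)).add (hP X Y)).sub (hP Y X)
  exact key.congr_deriv (by simp only [varRiemAt]; abel)

/-- Applied form: `s ↦ R_s(X,Y)Z` has derivative `(∂_t R(X,Y)) Z` within `S`.
[cite: Topping2006, Prop. 2.3.4] -/
theorem hasDerivWithinAt_riemAt_apply (hG : IsMetricFamilyOn G S V) (hx : x ∈ V) (ht : t ∈ S)
    (X Y Z : E) :
    HasDerivWithinAt (fun s ↦ riemAt (G s) x X Y Z) (varRiemAt G S t x X Y Z) S t := by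
  have h := (hG.hasDerivWithinAt_riemAt hx ht X Y).clm_apply (hasDerivWithinAt_const t S Z)
  simpa using h

end IsMetricFamilyOn

end MetricCoord

end Literature.Geometry.Lorentzian

end
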